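import Mathlib.LinearAlgebra.Matrix.PosDef
import Mathlib.LinearAlgebra.Matrix.NonsingularInverse
import HarnessLib

/-!
# Z-matrices: nonnegative inverses and the bordering formula

Helper file for `Summit.CriticalPhenomena.Ising3DConformalLimit.Theses.PrecisionLaplacian.EtaBoundsTransfer`
(item stmt-CriticalPhenomena-4804).  Elementary real matrix facts:

* `inv_entry_nonneg_of_posDef_of_offDiag_nonpos` — a real positive-definite matrix whose
  off-diagonal entries are `≤ 0` (a positive-definite Z-matrix, i.e. a symmetric nonsingular
  M-matrix) has an entrywise nonnegative inverse (proof by the `|x|`-trick on the energy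
  `xᵀKx - 2bᵀx`);
* `inv_submatrix_ne_apply` — the bordering formula: for nonsingular `U` with `U⁻¹ k k ≠ 0`,
  `(U_{∖k})⁻¹ i j = U⁻¹ i j − U⁻¹ i k · U⁻¹ k j / U⁻¹ k k`
  (Dellacherie–Martínez–San Martín 2014, Lemma 2.32, eq. (2.6));
* `inv_submatrix_ne_apply_le` — hence `(U_{∖k})⁻¹ ≤ U⁻¹` entrywise when `U⁻¹` is a Z-matrix with
  positive diagonal.
-/

noncomputable section

open Matrix Finset

namespace Summit.CriticalPhenomena.Ising3DConformalLimit.Theorems.EtaBoundsTransfer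

variable {n : Type*} [Fintype n] [DecidableEq n]

omit [DecidableEq n] in
/-- For a real symmetric matrix, `x ⬝ᵥ K y = y ⬝ᵥ K x`. -/
theorem dotProduct_mulVec_comm_of_isSymm {K : Matrix n n ℝ} (hK : K.IsHermitian) (x y : n → ℝ) :
    x ⬝ᵥ (K *ᵥ y) = y ⬝ᵥ (K *ᵥ x) := by
  have hT : Kᵀ = K := by
    have := hK
    rw [Matrix.IsHermitian, Matrix.conjTranspose_eq_transpose_of_trivial] at this
    exact this
  calc x ⬝ᵥ (K *ᵥ y) = (x ᵥ* K) ⬝ᵥ y := (Matrix.dotProduct_mulVec x K y)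
    _ = (Kᵀ *ᵥ x) ⬝ᵥ y := by rw [Matrix.mulVec_transpose]
    _ = (K *ᵥ x) ⬝ᵥ y := by rw [hT]
    _ = y ⬝ᵥ (K *ᵥ x) := dotProduct_comm _ _

/-- **A positive-definite real Z-matrix has a nonnegative inverse.**  If `K` is positive definite
and `K i j ≤ 0` for `i ≠ j`, then `0 ≤ K⁻¹ i j` for all `i, j`.  Proof: with `x = K⁻¹ e_j` and
`y = |x|` one has `yᵀKy ≤ xᵀKx` and `e_jᵀ y ≥ e_jᵀ x`, whence `(y-x)ᵀK(y-x) ≤ 0`, so `y = x`. -/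
theorem inv_entry_nonneg_of_posDef_of_offDiag_nonpos {K : Matrix n n ℝ} (hK : K.PosDef)
    (hZ : ∀ i j, i ≠ j → K i j ≤ 0) (i j : n) : 0 ≤ K⁻¹ i j := by
  have hdet : IsUnit K.det := (Matrix.isUnit_iff_isUnit_det K).mp hK.isUnit
  -- the column `x = K⁻¹ e_j`
  set x : n → ℝ := fun i => K⁻¹ i j with hx
  set y : n → ℝ := fun i => |x i| with hy
  have hKx : K *ᵥ x = Pi.single j 1 := by
    have h1 : x = K⁻¹ *ᵥ Pi.single j 1 := by
      funext i
      simp [hx, Matrix.mulVec, dotProduct, Pi.single_apply]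
    rw [h1, Matrix.mulVec_mulVec, Matrix.mul_nonsing_inv _ hdet, Matrix.one_mulVec]
  -- energy comparison `yᵀKy ≤ xᵀKx`
  have hD : y ⬝ᵥ (K *ᵥ y) ≤ x ⬝ᵥ (K *ᵥ x) := by
    simp only [dotProduct, Matrix.mulVec, Finset.mul_sum]
    apply Finset.sum_le_sum
    intro a _
    apply Finset.sum_le_sum
    intro b _
    by_cases hab : a = b
    · subst hab
      have h0 : y a * y a = x a * x a := by simp [hy]
      have e1 : y a * (K a a * y a) = K a a * (y a * y a) := by ring
      have e2 : x a * (K a a * x a) = K a a * (x a * x a) := by ring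
      rw [e1, e2, h0]
    · have hKab := hZ a b hab
      have h1 : x a * x b ≤ y a * y b := by
        simp only [hy]; rw [← abs_mul]; exact le_abs_self _
      nlinarith [hKab, h1]
  have hsymm := dotProduct_mulVec_comm_of_isSymm hK.isHermitian x y
  have hyKx : y ⬝ᵥ (K *ᵥ x) = y j := by rw [hKx]; simp
  have hxKx : x ⬝ᵥ (K *ᵥ x) = x j := by rw [hKx]; simp
  have hquad : (y - x) ⬝ᵥ (K *ᵥ (y - x)) ≤ 0 := by
    rw [Matrix.mulVec_sub, sub_dotProduct, dotProduct_sub, dotProduct_sub, hsymm, hyKx, hxKx]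
    have : x j ≤ y j := le_abs_self _
    linarith
  have hyx : y - x = 0 := by
    by_contra hne
    have := hK.dotProduct_mulVec_pos hne
    simp only [star_trivial] at this
    linarith
  have : y i = x i := by
    have := congr_fun hyx i
    simp only [Pi.sub_apply, Pi.zero_apply] at this
    linarith
  calc (0 : ℝ) ≤ |x i| := abs_nonneg _
    _ = x i := this
    _ = K⁻¹ i j := rfl

/-- **Bordering formula** (DMS 2014, Lemma 2.32, eq. (2.6)): for nonsingular `U` with
`U⁻¹ k k ≠ 0`, the inverse of the principal submatrix erasing `k` is
`(U_{∖k})⁻¹ i j = U⁻¹ i j − U⁻¹ i k · U⁻¹ k j / U⁻¹ k k`. -/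
theorem inv_submatrix_ne_apply (U : Matrix n n ℝ) (hU : IsUnit U.det) (k : n)
    (hk : U⁻¹ k k ≠ 0) (i j : {i : n // i ≠ k}) :
    (U.submatrix (Subtype.val : {i : n // i ≠ k} → n) Subtype.val)⁻¹ i j
      = U⁻¹ i.1 j.1 - U⁻¹ i.1 k * U⁻¹ k j.1 / U⁻¹ k k := by
  set V := U⁻¹ with hV
  set W : Matrix {i : n // i ≠ k} {i : n // i ≠ k} ℝ :=
    fun i j => V i.1 j.1 - V i.1 k * V k j.1 / V k k with hW
  suffices h : (U.submatrix (Subtype.val : {i : n // i ≠ k} → n) Subtype.val) * W = 1 by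
    rw [Matrix.inv_eq_right_inv h]
  ext i l
  have hUV : U * V = 1 := Matrix.mul_nonsing_inv _ hU
  have hs : ∀ m : n, ∑ j : {j : n // j ≠ k}, U i.1 j.1 * V j.1 m
      = (if i.1 = m then 1 else 0) - U i.1 k * V k m := by
    intro m
    have h1 : ∑ j : n, U i.1 j * V j m = if i.1 = m then 1 else 0 := by
      have := congr_fun (congr_fun hUV i.1) m
      simpa [Matrix.mul_apply, Matrix.one_apply] using this
    have h2 : ∑ j : {j : n // j ≠ k}, U i.1 j.1 * V j.1 m
        = ∑ j ∈ (Finset.univ.erase k), U i.1 j * V j m :=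
      (Finset.sum_subtype (Finset.univ.erase k) (fun x => by simp) (fun j => U i.1 j * V j m)).symm
    rw [h2, Finset.sum_erase_eq_sub (Finset.mem_univ k), h1]
  simp only [Matrix.mul_apply, Matrix.submatrix_apply, hW, Matrix.one_apply]
  have hik : (if i.1 = k then (1:ℝ) else 0) = 0 := if_neg i.2
  calc ∑ j : {j : n // j ≠ k}, U i.1 j.1 * (V j.1 l.1 - V j.1 k * V k l.1 / V k k)
      = ∑ j : {j : n // j ≠ k}, (U i.1 j.1 * V j.1 l.1
          - (U i.1 j.1 * V j.1 k) * (V k l.1 / V k k)) := by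
        refine Finset.sum_congr rfl fun j _ => ?_
        ring
    _ = ∑ j : {j : n // j ≠ k}, U i.1 j.1 * V j.1 l.1
          - (∑ j : {j : n // j ≠ k}, U i.1 j.1 * V j.1 k) * (V k l.1 / V k k) := by
        rw [Finset.sum_sub_distrib, Finset.sum_mul]
    _ = (if i.1 = l.1 then 1 else 0) := by
        rw [hs l.1, hs k, hik]
        field_simp
        ring
    _ = if i = l then 1 else 0 := by
        simp [Subtype.ext_iff]

/-- **Erasing an index decreases the inverse entries** for inverse Z-matrices with positive
diagonal: if `U⁻¹ k k > 0`, `U⁻¹ i k ≤ 0` and `U⁻¹ k j ≤ 0` (`i, j ≠ k`), then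
`(U_{∖k})⁻¹ i j ≤ U⁻¹ i j` (DMS 2014, proof of Lemma 2.32). -/
theorem inv_submatrix_ne_apply_le (U : Matrix n n ℝ) (hU : IsUnit U.det) (k : n)
    (hk : 0 < U⁻¹ k k) (i j : {i : n // i ≠ k}) (hik : U⁻¹ i.1 k ≤ 0) (hkj : U⁻¹ k j.1 ≤ 0) :
    (U.submatrix (Subtype.val : {i : n // i ≠ k} → n) Subtype.val)⁻¹ i j ≤ U⁻¹ i.1 j.1 := by
  rw [inv_submatrix_ne_apply U hU k hk.ne' i j]
  have : 0 ≤ U⁻¹ i.1 k * U⁻¹ k j.1 / U⁻¹ k k :=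
    div_nonneg (mul_nonneg_of_nonpos_of_nonpos hik hkj) hk.le
  linarith

end Summit.CriticalPhenomena.Ising3DConformalLimit.Theorems.EtaBoundsTransfer
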